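import Mathlib
import Literature.Analysis.FluidPDE.SelfSimilarEulerProfile
import HarnessLib

/-!
# Crux `EulerZoomLiouville.PowerGaugeEulerLiouville` (stmt-NavierStokesRegularity-19832), nsreg-p2 ROUND-57 «THE LEDGER CLOSES», plate t60-SEAM:
# THE PRESSURE-BUDGET SEAM (modulo-constants log budget ⇒ single-normalisation log budget, `ρ > −1`)

Seat ns-ezl-w1 g9 (`--supports stmt-NavierStokesRegularity-19832 --as helper`; planner nsreg-p2 g45's key t60-SEAM, 2026-08-29 11:34Z).
VERBATIM port of `P2/r57/Seam57.lean` (sha16 807c113eedfbb624, author nsreg-p2 g45; `E3` spelled out, the trailing `#print axioms` receipts kept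
in the seat's HOME by-name file) — the referee's ONE SEAM of SCORE-p2-ROUND-57 (F6/R2) closed in the tree:

t60-ΠLOG delivers the pressure budget MODULO CONSTANTS, scale by scale (`∀ R ≥ 1, ∃ c_R, ∫_{B_R}|P − c_R| ≤ D·R^{1−2ρ}(1+log R)`), while the
trace laws (`WeakTrace.weakTraceLawLog`, A9 `WeakTrace.weakTraceLaw_allTests`) hypothesise `∫_{B_R}|P| ≤ …` for ONE normalisation of `P`.
For `ρ > −1` the constants `c_R` STABILISE along dyadic radii (Campanato-type telescoping, `|c_R − c_{2R}|·|B_R| ≤ 2 budgets`, exponent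
`(1−2ρ) − 3 = −2−2ρ < 0`), the limit `κ` exists, `P − κ` obeys the single-normalisation budget with the same shape, and `(V, P − κ)` is again a
profile pair (the profile structure sees only `∇P`):

* `PressureSeam.PressureBudgetLog ρ P`, `PressureSeam.PressureBudgetLogMod ρ P` — the two budget shapes (defs);
* `PressureSeam.budgetLogMod_of_budgetLog` — the trivial direction;
* `PressureSeam.stabilisation (hρ : -1 < ρ)` — dyadic stabilisation of the constants;
* `PressureSeam.profile_sub_const` — `IsSelfSimilarEulerProfile γ c₀ U P → IsSelfSimilarEulerProfile γ c₀ U (P − κ)`;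
* `PressureSeam.consumes_mod (hρ : -1 < ρ)` — any law consuming the single-normalisation log budget for EVERY profile pressure of `V` consumes the
  modulo-constants budget.

HONEST FRAMING: instrument glue about HYPOTHETICAL profiles (not load-bearing for E); nothing about the crux E (19832 OPEN) or NS regularity; not E.
-/

noncomputable section

-- flat `Theorems/<Route><Decl>…` files of one crux share the namespace of the crux (tree convention)
set_option linter.dupNamespace false

open MeasureTheory Metric Filter Topology

namespace Summit.NavierStokesRegularity.NavierStokesRegularity.Theorems.PowerGaugeEulerLiouville.PressureSeam

/-- Pressure budget with the logarithm, ONE normalisation (the hypothesis shape of WTLOG with the log;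
A9's is the same without `(1 + log R)`). -/
def PressureBudgetLog (ρ : ℝ) (P : (EuclideanSpace ℝ (Fin 3)) → ℝ) : Prop :=
  ∃ D : ℝ, ∀ R : ℝ, 1 ≤ R →
    ∫ y in ball (0 : (EuclideanSpace ℝ (Fin 3))) R, |P y| ≤ D * (R ^ (1 - 2 * ρ) * (1 + Real.log R))

/-- Pressure budget with the logarithm MODULO CONSTANTS, scale by scale (the natural output of the
Calderón–Zygmund representation, t60-ΠLOG). -/
def PressureBudgetLogMod (ρ : ℝ) (P : (EuclideanSpace ℝ (Fin 3)) → ℝ) : Prop :=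
  ∃ D : ℝ, ∀ R : ℝ, 1 ≤ R → ∃ c : ℝ,
    ∫ y in ball (0 : (EuclideanSpace ℝ (Fin 3))) R, |P y - c| ≤ D * (R ^ (1 - 2 * ρ) * (1 + Real.log R))

/-- Sanity (the trivial direction): one normalisation is a choice of constants. -/
theorem budgetLogMod_of_budgetLog {ρ : ℝ} {P : (EuclideanSpace ℝ (Fin 3)) → ℝ} (h : PressureBudgetLog ρ P) :
    PressureBudgetLogMod ρ P := by
  obtain ⟨D, hD⟩ := h
  exact ⟨D, fun R hR => ⟨0, by simpa using hD R hR⟩⟩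

/-- **Dyadic stabilisation of the constants** (`ρ > −1`): a modulo-constants budget, scale by scale,
implies the single-normalisation budget for `P − κ` with a limiting constant `κ`. -/
theorem stabilisation {ρ : ℝ} (hρ : -1 < ρ) {P : (EuclideanSpace ℝ (Fin 3)) → ℝ} (hP : Continuous P)
    (h : PressureBudgetLogMod ρ P) : ∃ κ : ℝ, PressureBudgetLog ρ (fun y => P y - κ) := by
  classical
  obtain ⟨D₀, hD₀⟩ := h
  set a : ℝ := 1 - 2 * ρ with ha_def
  have ha3 : a - 3 < 0 := by rw [ha_def]; linarith
  set D : ℝ := max D₀ 0 with hD_def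
  have hD0 : 0 ≤ D := le_max_right _ _
  have hlogR : ∀ {R : ℝ}, 1 ≤ R → 0 ≤ Real.log R := fun hR => Real.log_nonneg hR
  have hXnn : ∀ {R : ℝ}, 1 ≤ R → 0 ≤ R ^ a * (1 + Real.log R) := fun {R} hR =>
    mul_nonneg (Real.rpow_nonneg (by linarith) _) (by linarith [hlogR hR])
  have hB : ∀ R : ℝ, 1 ≤ R → ∃ c : ℝ,
      ∫ y in ball (0 : (EuclideanSpace ℝ (Fin 3))) R, |P y - c| ≤ D * (R ^ a * (1 + Real.log R)) := by
    intro R hR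
    obtain ⟨c, hc⟩ := hD₀ R hR
    exact ⟨c, hc.trans (mul_le_mul_of_nonneg_right (le_max_left _ _) (hXnn hR))⟩
  -- integrability of `|P − c|` and of constants on balls
  have hint : ∀ (c R : ℝ), IntegrableOn (fun y : (EuclideanSpace ℝ (Fin 3)) => |P y - c|) (ball (0 : (EuclideanSpace ℝ (Fin 3))) R) := fun c R =>
    (((hP.sub continuous_const).abs).continuousOn.integrableOn_compact
      (isCompact_closedBall (0 : (EuclideanSpace ℝ (Fin 3))) R)).mono_set ball_subset_closedBall
  have hintc : ∀ (C R : ℝ), IntegrableOn (fun _ : (EuclideanSpace ℝ (Fin 3)) => C) (ball (0 : (EuclideanSpace ℝ (Fin 3))) R) := fun C R =>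
    ((continuous_const.continuousOn.integrableOn_compact
      (isCompact_closedBall (0 : (EuclideanSpace ℝ (Fin 3))) R)).mono_set ball_subset_closedBall)
  -- the volume of balls: `|B_R| = R³·|B_1|`
  set v₁ : ℝ := (volume (ball (0 : (EuclideanSpace ℝ (Fin 3))) 1)).toReal with hv₁_def
  have hv₁pos : 0 < v₁ := by
    rw [hv₁_def]
    exact ENNReal.toReal_pos (measure_ball_pos volume (0 : (EuclideanSpace ℝ (Fin 3))) one_pos).ne' measure_ball_lt_top.ne
  have hv₁ne : v₁ ≠ 0 := hv₁pos.ne'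
  have hvol : ∀ {R : ℝ}, 0 ≤ R → (volume (ball (0 : (EuclideanSpace ℝ (Fin 3))) R)).toReal = R ^ 3 * v₁ := by
    intro R hR
    rw [Measure.addHaar_ball volume (0 : (EuclideanSpace ℝ (Fin 3))) hR, ENNReal.toReal_mul,
      ENNReal.toReal_ofReal (pow_nonneg hR _), finrank_euclideanSpace_fin]
  have hconst : ∀ (C : ℝ) {R : ℝ}, 0 ≤ R → ∫ _ in ball (0 : (EuclideanSpace ℝ (Fin 3))) R, C = C * (R ^ 3 * v₁) := by
    intro C R hR
    rw [setIntegral_const, measureReal_def, hvol hR, smul_eq_mul, mul_comm]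
  -- comparison of two constants on one ball
  have hcmp : ∀ (c c' : ℝ) {R : ℝ}, 0 < R →
      |c - c'| * (R ^ 3 * v₁) ≤
        (∫ y in ball (0 : (EuclideanSpace ℝ (Fin 3))) R, |P y - c|) + ∫ y in ball (0 : (EuclideanSpace ℝ (Fin 3))) R, |P y - c'| := by
    intro c c' R hR
    rw [← hconst _ hR.le, ← integral_add (hint c R) (hint c' R)]
    refine setIntegral_mono (hintc _ R) ((hint c R).add (hint c' R)) fun y => ?_
    have := abs_sub_le c (P y) c'
    rwa [abs_sub_comm c (P y)] at this
  -- monotonicity in the radius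
  have hmono : ∀ (c : ℝ) {R R' : ℝ}, R ≤ R' →
      ∫ y in ball (0 : (EuclideanSpace ℝ (Fin 3))) R, |P y - c| ≤ ∫ y in ball (0 : (EuclideanSpace ℝ (Fin 3))) R', |P y - c| :=
    fun c R R' hRR' => setIntegral_mono_set (hint c R')
      (ae_of_all _ fun y => abs_nonneg _) (ae_of_all _ (ball_subset_ball hRR'))
  -- dyadic radii and their constants
  have hr1 : ∀ k : ℕ, (1 : ℝ) ≤ 2 ^ k := fun k => one_le_pow₀ (by norm_num)
  have hr0 : ∀ k : ℕ, (0 : ℝ) < 2 ^ k := fun k => pow_pos two_pos k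
  choose c hc using fun k : ℕ => hB (2 ^ k) (hr1 k)
  -- constants `M = max 1 2^a`, `q = 2^{a−3} < 1`, `K = 2DM/|B_1|`
  set M : ℝ := max 1 ((2 : ℝ) ^ a) with hM_def
  have hM1 : 1 ≤ M := le_max_left _ _
  have hM0 : 0 ≤ M := zero_le_one.trans hM1
  have hdouble : ∀ {x : ℝ}, 0 < x → (2 * x) ^ a ≤ M * x ^ a := fun {x} hx => by
    rw [Real.mul_rpow zero_le_two hx.le]
    exact mul_le_mul_of_nonneg_right (le_max_right _ _) (Real.rpow_nonneg hx.le _)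
  have hsingle : ∀ {x : ℝ}, 0 < x → x ^ a ≤ M * x ^ a := fun {x} hx =>
    le_mul_of_one_le_left (Real.rpow_nonneg hx.le _) hM1
  have hlog2 : Real.log 2 ≤ 1 := by
    have := Real.log_two_lt_d9; norm_num at this; linarith
  have hlog2' : (1 : ℝ) / 2 < Real.log 2 := by
    have := Real.log_two_gt_d9; norm_num at this; linarith
  have hlogpow : ∀ k : ℕ, 1 + Real.log ((2 : ℝ) ^ k) ≤ (k : ℝ) + 1 := fun k => by
    rw [Real.log_pow]
    have := mul_le_of_le_one_right (Nat.cast_nonneg k : (0 : ℝ) ≤ k) hlog2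
    linarith
  set q : ℝ := (2 : ℝ) ^ (a - 3) with hq_def
  have hq0 : 0 < q := Real.rpow_pos_of_pos two_pos _
  have hq1 : q < 1 := Real.rpow_lt_one_of_one_lt_of_neg one_lt_two ha3
  have hqpow : ∀ k : ℕ, ((2 : ℝ) ^ k) ^ (a - 3) = q ^ k := fun k => by
    rw [← Real.rpow_natCast 2 k, ← Real.rpow_mul zero_le_two, mul_comm, Real.rpow_mul zero_le_two,
      Real.rpow_natCast]
  have hsplit : ∀ k : ℕ, ((2 : ℝ) ^ k) ^ a = q ^ k * ((2 : ℝ) ^ k) ^ 3 := fun k => by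
    have hx := hr0 k
    have h3 : ((2 : ℝ) ^ k) ^ (3 : ℝ) = ((2 : ℝ) ^ k) ^ (3 : ℕ) := by
      exact_mod_cast Real.rpow_natCast ((2 : ℝ) ^ k) 3
    rw [← hqpow, Real.rpow_sub hx a (3 : ℝ), h3, div_mul_cancel₀ _ (pow_ne_zero 3 hx.ne')]
  set K : ℝ := 2 * D * M / v₁ with hK_def
  have hK0 : 0 ≤ K := div_nonneg (by positivity) hv₁pos.le
  -- the dyadic increments: `|c_k − c_{k+1}| ≤ K (k+2) q^k`
  have hdist : ∀ k : ℕ, dist (c k) (c (k + 1)) ≤ K * (((k : ℝ) + 2) * q ^ k) := by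
    intro k
    have hx := hr0 k
    have h1 : ∫ y in ball (0 : (EuclideanSpace ℝ (Fin 3))) (2 ^ k), |P y - c k| ≤ D * M * ((k : ℝ) + 2) * ((2 : ℝ) ^ k) ^ a := by
      refine (hc k).trans ?_
      have hl : 1 + Real.log ((2 : ℝ) ^ k) ≤ (k : ℝ) + 2 := by linarith [hlogpow k]
      have hl0 : 0 ≤ 1 + Real.log ((2 : ℝ) ^ k) := by linarith [hlogR (hr1 k)]
      calc D * (((2 : ℝ) ^ k) ^ a * (1 + Real.log ((2 : ℝ) ^ k)))
          ≤ D * ((M * ((2 : ℝ) ^ k) ^ a) * ((k : ℝ) + 2)) :=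
            mul_le_mul_of_nonneg_left (mul_le_mul (hsingle hx) hl hl0 (by positivity)) hD0
        _ = D * M * ((k : ℝ) + 2) * ((2 : ℝ) ^ k) ^ a := by ring
    have h2 : ∫ y in ball (0 : (EuclideanSpace ℝ (Fin 3))) (2 ^ k), |P y - c (k + 1)| ≤
        D * M * ((k : ℝ) + 2) * ((2 : ℝ) ^ k) ^ a := by
      refine (hmono (c (k + 1)) (pow_le_pow_right₀ one_le_two (Nat.le_succ k))).trans
        ((hc (k + 1)).trans ?_)
      have hl : 1 + Real.log ((2 : ℝ) ^ (k + 1)) ≤ (k : ℝ) + 2 := by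
        have := hlogpow (k + 1); push_cast at this; linarith
      have hl0 : 0 ≤ 1 + Real.log ((2 : ℝ) ^ (k + 1)) := by linarith [hlogR (hr1 (k + 1))]
      have hd : ((2 : ℝ) ^ (k + 1)) ^ a ≤ M * ((2 : ℝ) ^ k) ^ a := by
        rw [pow_succ, mul_comm]; exact hdouble hx
      calc D * (((2 : ℝ) ^ (k + 1)) ^ a * (1 + Real.log ((2 : ℝ) ^ (k + 1))))
          ≤ D * ((M * ((2 : ℝ) ^ k) ^ a) * ((k : ℝ) + 2)) :=
            mul_le_mul_of_nonneg_left (mul_le_mul hd hl hl0 (by positivity)) hD0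
        _ = D * M * ((k : ℝ) + 2) * ((2 : ℝ) ^ k) ^ a := by ring
    have hv3 : 0 < ((2 : ℝ) ^ k) ^ 3 * v₁ := mul_pos (pow_pos hx 3) hv₁pos
    have h4 : |c k - c (k + 1)| * (((2 : ℝ) ^ k) ^ 3 * v₁) ≤
        (K * (((k : ℝ) + 2) * q ^ k)) * (((2 : ℝ) ^ k) ^ 3 * v₁) := by
      calc |c k - c (k + 1)| * (((2 : ℝ) ^ k) ^ 3 * v₁)
          ≤ (∫ y in ball (0 : (EuclideanSpace ℝ (Fin 3))) (2 ^ k), |P y - c k|) + ∫ y in ball (0 : (EuclideanSpace ℝ (Fin 3))) (2 ^ k), |P y - c (k + 1)| :=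
            hcmp (c k) (c (k + 1)) hx
        _ ≤ D * M * ((k : ℝ) + 2) * ((2 : ℝ) ^ k) ^ a + D * M * ((k : ℝ) + 2) * ((2 : ℝ) ^ k) ^ a :=
            add_le_add h1 h2
        _ = (K * (((k : ℝ) + 2) * q ^ k)) * (((2 : ℝ) ^ k) ^ 3 * v₁) := by
            rw [hsplit k, hK_def]; field_simp; ring
    rw [Real.dist_eq]
    exact le_of_mul_le_mul_right h4 hv3
  -- summability of the increments, the limit constant, and the tail bound
  set d : ℕ → ℝ := fun k => K * (((k : ℝ) + 2) * q ^ k) with hd_def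
  have hgeom : Summable (fun k : ℕ => q ^ k) := summable_geometric_of_lt_one hq0.le hq1
  have hkq : Summable (fun k : ℕ => (k : ℝ) * q ^ k) := by
    have hnq : ‖q‖ < 1 := by rw [Real.norm_eq_abs, abs_of_pos hq0]; exact hq1
    simpa [pow_one] using summable_pow_mul_geometric_of_norm_lt_one 1 hnq
  have hS1 : Summable (fun k : ℕ => ((k : ℝ) + 1) * q ^ k) := by
    refine (hkq.add hgeom).congr fun k => ?_
    ring
  have hd_sum : Summable d := by
    refine ((hkq.add (hgeom.mul_left 2)).mul_left K).congr fun k => ?_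
    simp only [hd_def]; ring
  have hcauchy : CauchySeq c := cauchySeq_of_dist_le_of_summable d hdist hd_sum
  obtain ⟨κ, hκ⟩ := cauchySeq_tendsto_of_complete hcauchy
  set S : ℝ := ∑' m : ℕ, ((m : ℝ) + 1) * q ^ m with hS_def
  have hS0 : 0 ≤ S := tsum_nonneg fun m => by positivity
  have htail : ∀ n : ℕ, dist (c n) κ ≤ K * S * (((n : ℝ) + 2) * q ^ n) := by
    intro n
    refine (dist_le_tsum_of_dist_le_of_tendsto d hdist hd_sum hκ n).trans ?_
    have hsum_shift : Summable (fun m : ℕ => d (n + m)) := by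
      refine ((summable_nat_add_iff n).2 hd_sum).congr fun m => ?_
      rw [add_comm]
    have hbound : ∀ m : ℕ, d (n + m) ≤ (K * (((n : ℝ) + 2) * q ^ n)) * (((m : ℝ) + 1) * q ^ m) := by
      intro m
      simp only [hd_def, Nat.cast_add, pow_add]
      have h1 : (0 : ℝ) ≤ n := Nat.cast_nonneg n
      have h2 : (0 : ℝ) ≤ m := Nat.cast_nonneg m
      have hnm : (n : ℝ) + m + 2 ≤ ((n : ℝ) + 2) * ((m : ℝ) + 1) := by nlinarith [mul_nonneg h1 h2]
      calc K * (((n : ℝ) + m + 2) * (q ^ n * q ^ m))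
          ≤ K * ((((n : ℝ) + 2) * ((m : ℝ) + 1)) * (q ^ n * q ^ m)) :=
            mul_le_mul_of_nonneg_left (mul_le_mul_of_nonneg_right hnm (by positivity)) hK0
        _ = (K * (((n : ℝ) + 2) * q ^ n)) * (((m : ℝ) + 1) * q ^ m) := by ring
    calc ∑' m, d (n + m) ≤ ∑' m : ℕ, (K * (((n : ℝ) + 2) * q ^ n)) * (((m : ℝ) + 1) * q ^ m) :=
          hsum_shift.tsum_le_tsum hbound (hS1.mul_left _)
      _ = K * S * (((n : ℝ) + 2) * q ^ n) := by rw [tsum_mul_left, hS_def]; ring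
  -- assembly: the single-normalisation budget for `P − κ`
  refine ⟨κ, M * (2 * D + 3 * (K * S * v₁)), fun R hR => ?_⟩
  show ∫ y in ball (0 : (EuclideanSpace ℝ (Fin 3))) R, |P y - κ| ≤
    M * (2 * D + 3 * (K * S * v₁)) * (R ^ (1 - 2 * ρ) * (1 + Real.log R))
  rw [← ha_def]
  have hR0 : 0 < R := by linarith
  obtain ⟨n, hn, hn'⟩ := exists_nat_pow_near hR one_lt_two
  have hx := hr0 (n + 1)
  have s1 : ∫ y in ball (0 : (EuclideanSpace ℝ (Fin 3))) R, |P y - κ| ≤ ∫ y in ball (0 : (EuclideanSpace ℝ (Fin 3))) (2 ^ (n + 1)), |P y - κ| :=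
    hmono κ hn'.le
  have s2 : ∫ y in ball (0 : (EuclideanSpace ℝ (Fin 3))) (2 ^ (n + 1)), |P y - κ| ≤
      (∫ y in ball (0 : (EuclideanSpace ℝ (Fin 3))) (2 ^ (n + 1)), |P y - c (n + 1)|) +
        |c (n + 1) - κ| * (((2 : ℝ) ^ (n + 1)) ^ 3 * v₁) := by
    rw [← hconst _ hx.le, ← integral_add (hint _ _) (hintc _ _)]
    refine setIntegral_mono (hint κ _) ((hint _ _).add (hintc _ _)) fun y => ?_
    exact abs_sub_le (P y) (c (n + 1)) κ
  have s3 := hc (n + 1)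
  have s4 : |c (n + 1) - κ| ≤ K * S * (((n : ℝ) + 1 + 2) * q ^ (n + 1)) := by
    have := htail (n + 1); rw [Real.dist_eq] at this; push_cast at this; linarith
  have s5 : ((2 : ℝ) ^ (n + 1)) ^ a ≤ M * R ^ a := by
    rcases le_or_gt 0 a with ha0 | ha0
    · calc ((2 : ℝ) ^ (n + 1)) ^ a ≤ (2 * R) ^ a :=
            Real.rpow_le_rpow hx.le (by rw [pow_succ]; linarith [hn]) ha0
        _ ≤ M * R ^ a := hdouble hR0
    · calc ((2 : ℝ) ^ (n + 1)) ^ a ≤ R ^ a := Real.rpow_le_rpow_of_nonpos hR0 hn'.le ha0.le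
        _ ≤ M * R ^ a := hsingle hR0
  have s6 : 1 + Real.log ((2 : ℝ) ^ (n + 1)) ≤ 2 * (1 + Real.log R) := by
    have h2R : (2 : ℝ) ^ (n + 1) ≤ 2 * R := by rw [pow_succ]; linarith [hn]
    have := Real.log_le_log hx h2R
    rw [Real.log_mul two_ne_zero hR0.ne'] at this
    linarith [hlog2, hlogR hR]
  have s7 : (n : ℝ) + 1 + 2 ≤ 3 * (1 + Real.log R) := by
    have := Real.log_le_log (hr0 n) hn
    rw [Real.log_pow] at this
    nlinarith [mul_nonneg (Nat.cast_nonneg n : (0 : ℝ) ≤ n) (sub_nonneg.2 hlog2'.le), hlogR hR]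
  have hlog1 : 0 ≤ 1 + Real.log R := by linarith [hlogR hR]
  have hlogx : 0 ≤ 1 + Real.log ((2 : ℝ) ^ (n + 1)) := by linarith [hlogR (hr1 (n + 1))]
  calc ∫ y in ball (0 : (EuclideanSpace ℝ (Fin 3))) R, |P y - κ|
      ≤ (∫ y in ball (0 : (EuclideanSpace ℝ (Fin 3))) (2 ^ (n + 1)), |P y - c (n + 1)|) +
          |c (n + 1) - κ| * (((2 : ℝ) ^ (n + 1)) ^ 3 * v₁) := s1.trans s2
    _ ≤ D * (((2 : ℝ) ^ (n + 1)) ^ a * (1 + Real.log ((2 : ℝ) ^ (n + 1)))) +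
          (K * S * (((n : ℝ) + 1 + 2) * q ^ (n + 1))) * (((2 : ℝ) ^ (n + 1)) ^ 3 * v₁) :=
        add_le_add s3 (mul_le_mul_of_nonneg_right s4 (by positivity))
    _ = (D * (1 + Real.log ((2 : ℝ) ^ (n + 1))) + K * S * v₁ * ((n : ℝ) + 1 + 2)) *
          ((2 : ℝ) ^ (n + 1)) ^ a := by
        rw [hsplit (n + 1)]; ring
    _ ≤ (D * (2 * (1 + Real.log R)) + K * S * v₁ * (3 * (1 + Real.log R))) * (M * R ^ a) := by
        apply mul_le_mul _ s5 (Real.rpow_nonneg hx.le _) _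
        · exact add_le_add (mul_le_mul_of_nonneg_left s6 hD0)
            (mul_le_mul_of_nonneg_left s7 (by positivity))
        · exact add_nonneg (mul_nonneg hD0 (by positivity)) (by positivity)
    _ = M * (2 * D + 3 * (K * S * v₁)) * (R ^ a * (1 + Real.log R)) := by ring

open Literature.Analysis.FluidPDE in
/-- Profile pairs are invariant under `P ↦ P − κ` (the structure sees only `∇P`). -/
theorem profile_sub_const {γ : ℝ} {c₀ : (EuclideanSpace ℝ (Fin 3))} {U : (EuclideanSpace ℝ (Fin 3)) → (EuclideanSpace ℝ (Fin 3))} {P : (EuclideanSpace ℝ (Fin 3)) → ℝ}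
    (h : IsSelfSimilarEulerProfile γ c₀ U P) (κ : ℝ) :
    IsSelfSimilarEulerProfile γ c₀ U (fun y => P y - κ) where
  contDiff_velocity := h.contDiff_velocity
  contDiff_pressure := h.contDiff_pressure.sub contDiff_const
  profile_eq := fun y => by
    have hg : gradient (fun y => P y - κ) y = gradient P y := by
      unfold gradient; rw [fderiv_sub_const]
    rw [hg]; exact h.profile_eq y
  divFree := h.divFree

open Literature.Analysis.FluidPDE in
/-- **The seam closes.** Any law that consumes the single-normalisation log budget for EVERY profile
pressure of `V` (the shape of WTLOG `NsregP2.R56.Log.weakTraceLawLog`, quantified over `P`) consumes the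
modulo-constants budget delivered by t60-ΠLOG, for `ρ > −1` — no tree theorem is re-typed. -/
theorem consumes_mod {ρ γ : ℝ} (hρ : -1 < ρ) {V : (EuclideanSpace ℝ (Fin 3)) → (EuclideanSpace ℝ (Fin 3))} {Concl : Prop}
    (hlaw : ∀ P : (EuclideanSpace ℝ (Fin 3)) → ℝ, IsSelfSimilarEulerProfile γ 0 V P → PressureBudgetLog ρ P → Concl)
    {P : (EuclideanSpace ℝ (Fin 3)) → ℝ} (hprof : IsSelfSimilarEulerProfile γ 0 V P) (hmod : PressureBudgetLogMod ρ P) :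
    Concl := by
  obtain ⟨κ, hκ⟩ := stabilisation hρ hprof.contDiff_pressure.continuous hmod
  exact hlaw _ (profile_sub_const hprof κ) hκ

end Summit.NavierStokesRegularity.NavierStokesRegularity.Theorems.PowerGaugeEulerLiouville.PressureSeam

end
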